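import Mathlib
import Literature.Probability.Percolation.DiagonalStripMatrixQKZUniqueness
import Literature.Probability.Percolation.DiagonalStripVertexResidueSums
import Literature.Probability.LatticeModels.TemperleyLiebSpinChain
import HarnessLib

/-!
# Uniqueness of the boundary qKZ solution on the vertex (spin-chain) representation

Topic `Literature/Probability/Percolation`. The cocycle uniqueness theorem for constant representations
(`DiagonalStripMatrixQKZUniqueness`) is instantiated on the sector of the spin chain of `2m+1` sites
with `m` down spins, the Temperley–Lieb generators acting by `U_{s,s+1}` (`TemperleyLiebSpinChain`):
* the sector, the matrices of `U` on it and their relation to `spinTL` (**`secU`**, **`vecMul_secU_eq_spinTL`**);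
* the exchange relation `[q z_t/z_s] Φ_σ - [z_s/z_t] (U Φ)_σ = [q z_s/z_t] σ_s Φ_σ` in the matrix form
  of the cocycle argument (**`hexV_of_exchange`**);
* **the product `U_1 U_3 ⋯ U_{2m-1}` has rank one on the sector** (**`vecMul_oddProd_line`**): every
  `x ᵥ* (U_1 U_3 ⋯)` is a multiple of the fixed row `w₀` (alternating pairs, weight `(-q)^{#↓↑}`);
* hence **any two solutions of the exact system on the sector are proportional over the rapidity field**
  (**`vertex_solutions_proportional`**).

## References

* Y. Ikhlef, A. K. Ponsaing, *Finite-size left-passage probability in percolation*, J. Stat. Phys.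
  149 (2012) 10–36, arXiv:1202.5476, §3.4 (20)–(22). [IkhlefPonsaing2012]
* C. Hagendorf, J. Liénardy, *The open XXZ chain at Δ = -1/2 and the boundary quantum
  Knizhnik–Zamolodchikov equations*, J. Stat. Mech. (2021) 013104, arXiv:2008.03220, §2. [HagendorfLienardy2021]
-/

noncomputable section

namespace Literature.Probability.Percolation

open Finset MvPolynomial _root_.Matrix Literature.Probability.LatticeModels Literature.Probability.LatticeModels.TemperleyLieb

variable {L n : ℕ}

/-! ### The sector and the generator matrices on it -/

section Sector

/-- The sector of the spin chain of `L` sites with `n` down spins. [folklore] -/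
abbrev VSec (L n : ℕ) : Type := {σ : SpinConfig L // downCount σ = n}

/-- A move inside the sector. [folklore] -/
def flipV {s t : Fin L} (hst : s ≠ t) (σ : VSec L n) : VSec L n :=
  ⟨spinFlip s t σ.1, by rw [downCount_spinFlip hst]; exact σ.2⟩

/-- Extension by zero of a vector on the sector. [folklore] -/
def extV {K : Type*} [Zero K] (v : VSec L n → K) : SpinConfig L → K := fun σ => if h : downCount σ = n then v ⟨σ, h⟩ else 0

/-- The extension on the sector. [folklore] -/
theorem extV_apply {K : Type*} [Zero K] (v : VSec L n → K) (σ : VSec L n) : extV v σ.1 = v σ := by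
  unfold extV; rw [dif_pos σ.2]

variable {K : Type*} [Field K]

/-- **The matrix of `U_{s,t}` on the sector**, acting on row vectors: `x ᵥ* secU = U x`. [folklore] -/
def secU (q : K) (s t : Fin L) : Matrix (VSec L n) (VSec L n) K := fun σ' σ =>
  if σ.1 s = σ.1 t then 0 else (if σ' = σ then tlDiag q (σ.1 s) else 0) + (if σ'.1 = spinFlip s t σ.1 then 1 else 0)

/-- **Row vectors times `secU` is `spinTL`.** [folklore] -/
theorem vecMul_secU (q : K) {s t : Fin L} (hst : s ≠ t) (x : VSec L n → K) (σ : VSec L n) :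
    (x ᵥ* secU q s t) σ = if σ.1 s = σ.1 t then 0 else tlDiag q (σ.1 s) * x σ + x (flipV hst σ) := by
  rw [vecMul, dotProduct]
  by_cases h : σ.1 s = σ.1 t
  · rw [if_pos h]
    exact Finset.sum_eq_zero fun σ' _ => by simp [secU, h]
  · rw [if_neg h]
    simp only [secU, if_neg h, mul_add, mul_ite, mul_zero, Finset.sum_add_distrib, Finset.sum_ite_eq', Finset.mem_univ, if_true]
    congr 1
    · ring
    · rw [Finset.sum_eq_single (flipV hst σ)]
      · simp [flipV]
      · intro σ' _ hne
        rw [if_neg]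
        intro h'
        exact hne (Subtype.ext h')
      · intro h'; exact absurd (Finset.mem_univ _) h'

/-- **Row vectors times `secU`, through the extension**: `(x ᵥ* secU) σ = (U (ext x)) σ`. [folklore] -/
theorem vecMul_secU_eq_spinTL (q : K) {s t : Fin L} (hst : s ≠ t) (x : VSec L n → K) (σ : VSec L n) :
    (x ᵥ* secU q s t) σ = spinTL q s t (extV x) σ.1 := by
  rw [vecMul_secU q hst]
  by_cases h : σ.1 s = σ.1 t
  · rw [if_pos h, spinTL_apply_of_eq _ _ _ h]
  · rw [if_neg h, spinTL_apply_of_ne' h, extV_apply]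
    congr 1
    exact (extV_apply x (flipV hst σ)).symm

end Sector

/-! ### The constant family and the exchange relation in matrix form -/

section Family

/-- The generator family of the vertex representation: `E_i = U_{i-1,i}` (sites `0`-based) for
`1 ≤ i ≤ L-1`, zero otherwise. [folklore] -/
def vE (L n : ℕ) (q : ℂ) (i : ℕ) : Matrix (VSec L n) (VSec L n) ℂ :=
  if h : 1 ≤ i ∧ i + 1 ≤ L then secU q (⟨i - 1, by omega⟩ : Fin L) ⟨i, by omega⟩ else 0

/-- `genC` of an inverse. [folklore] -/
theorem genC_inv' (a : ℂ) : genC ℂ a⁻¹ = (genC ℂ a)⁻¹ := by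
  by_cases ha : a = 0
  · subst ha; unfold genC; simp
  · refine (eq_inv_of_mul_eq_one_left ?_)
    unfold genC; rw [← map_mul, ← C_mul, inv_mul_cancel₀ ha, C_1, map_one]

/-- `genC` of zero. [folklore] -/
theorem genC_zero' : genC ℂ (0 : ℂ) = 0 := by unfold genC; rw [C_0, map_zero]

/-- `genC` of one. [folklore] -/
theorem genC_one' : genC ℂ (1 : ℂ) = 1 := by unfold genC; rw [C_1, map_one]

/-- `genC` of a sum. [folklore] -/
theorem genC_add' (a b : ℂ) : genC ℂ (a + b) = genC ℂ a + genC ℂ b := by unfold genC; rw [C_add, map_add]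

/-- `genC` of the diagonal weight. [folklore] -/
theorem genC_tlDiag (q : ℂ) (b : Bool) : genC ℂ (tlDiag q b) = tlDiag (genC ℂ q) b := by
  cases b <;> simp only [tlDiag, Bool.false_eq_true, if_false, if_true, genC_neg, genC_inv']

/-- The generator matrices over the rapidity field. [folklore] -/
theorem map_secU_genC (q : ℂ) (s t : Fin L) : (secU (n := n) q s t).map (genC ℂ) = secU (genC ℂ q) s t := by
  ext σ' σ
  simp only [Matrix.map_apply, secU]
  split_ifs <;> simp only [genC_tlDiag, genC_zero', genC_one', genC_add']

variable {q : ℂ} (hq : q ^ 2 + q + 1 = 0) {i : ℕ} (hi1 : 1 ≤ i) (hiL : i + 1 ≤ L)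
include hi1 hiL

/-- The family at a level inside the chain. [folklore] -/
theorem eMat_vE : eMat (vE L n q) i = secU (genC ℂ q) (⟨i - 1, by omega⟩ : Fin L) ⟨i, by omega⟩ := by
  unfold eMat vE
  rw [dif_pos ⟨hi1, hiL⟩, map_secU_genC]

include hq

/-- **The exchange relation of a vector vanishing off the sector, in the matrix form of the cocycle
argument** (level `i`, sites `i-1, i`). [cite: IkhlefPonsaing2012, §3.4 (20)] -/
theorem hexV_of_exchange {Φ : SpinConfig L → RapidityField ℂ} (hzero : ∀ σ, downCount σ ≠ n → Φ σ = 0)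
    (hex : ∀ σ, qbr (genC ℂ q * zv (⟨i, by omega⟩ : Fin L) / zv (⟨i - 1, by omega⟩ : Fin L)) * Φ σ -
      qbr (zv (⟨i - 1, by omega⟩ : Fin L) / zv (⟨i, by omega⟩ : Fin L)) * spinTL (genC ℂ q) (⟨i - 1, by omega⟩ : Fin L) ⟨i, by omega⟩ Φ σ =
      qbr (genC ℂ q * zv (⟨i - 1, by omega⟩ : Fin L) / zv (⟨i, by omega⟩ : Fin L)) * genSwap ℂ i (Φ σ)) (σ : VSec L n) :
    genSwap ℂ i (Φ σ.1) = ((fun σ' : VSec L n => Φ σ'.1) ᵥ* eR (vE L n q) q i (genZ ℂ i) (genZ ℂ (i + 1))) σ := by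
  have hne : (⟨i - 1, by omega⟩ : Fin L) ≠ ⟨i, by omega⟩ := fun h => by have := congrArg Fin.val h; simp at this; omega
  have hext : extV (fun σ' : VSec L n => Φ σ'.1) = Φ := by
    funext τ; unfold extV
    by_cases h : downCount τ = n
    · rw [dif_pos h]
    · rw [dif_neg h, hzero τ h]
  have hi : i - 1 + 1 = i := by omega
  have hzs : zv (⟨i - 1, by omega⟩ : Fin L) = genZ ℂ i := by
    show genZ ℂ (i - 1 + 1) = genZ ℂ i; rw [hi]
  have hzt : zv (⟨i, by omega⟩ : Fin L) = genZ ℂ (i + 1) := rfl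
  refine exchangeE_matrix_of (Ec := vE L n q) (i := i) (v := fun σ' : VSec L n => Φ σ'.1) hq (fun σ' => ?_) σ
  rw [eMat_vE hi1 hiL, vecMul_secU_eq_spinTL _ hne, hext]
  have := hex σ'.1
  rw [hzs, hzt] at this
  exact this

end Family

/-! ### The product `U_1 U_3 ⋯ U_{2m-1}` has rank one on the sector -/

section RankOne

variable {m : ℕ} (q : ℂ)

/-- The left site `2j` of the `j`-th pair. [folklore] -/
def pL (j : Fin m) : Fin (2 * m + 1) := ⟨2 * j.val, by omega⟩

/-- The right site `2j+1` of the `j`-th pair. [folklore] -/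
def pR (j : Fin m) : Fin (2 * m + 1) := ⟨2 * j.val + 1, by omega⟩

/-- The two sites of a pair differ. [folklore] -/
theorem pL_ne_pR (j : Fin m) : pL j ≠ pR j := fun h => by have := congrArg Fin.val h; simp [pL, pR] at this

/-- Property A at the pair `j`: the vector vanishes on configurations with equal spins on the pair. [folklore] -/
def PropA (y : VSec (2 * m + 1) m → ℂ) (j : Fin m) : Prop := ∀ σ : VSec (2 * m + 1) m, σ.1 (pL j) = σ.1 (pR j) → y σ = 0

/-- Property B at the pair `j`: `y(↓↑) = -q · y(↑↓)`. [folklore] -/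
def PropB (y : VSec (2 * m + 1) m → ℂ) (j : Fin m) : Prop :=
  ∀ σ : VSec (2 * m + 1) m, σ.1 (pL j) = false → σ.1 (pR j) = true → y (flipV (pL_ne_pR j) σ) = -q * y σ

variable {q} (hq : q ^ 2 + q + 1 = 0)
include hq

/-- Multiplying by `U` at the pair `k` produces properties A and B at `k`. [folklore] -/
theorem propAB_vecMul_self (y : VSec (2 * m + 1) m → ℂ) (k : Fin m) :
    PropA (y ᵥ* secU q (pL k) (pR k)) k ∧ PropB q (y ᵥ* secU q (pL k) (pR k)) k := by
  have hq0 := ne_zero_of_quad hq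
  refine ⟨fun σ h => by rw [vecMul_secU q (pL_ne_pR k), if_pos h], fun σ h1 h2 => ?_⟩
  have hf1 : (flipV (pL_ne_pR k) σ).1 (pL k) = true := by
    show spinFlip (pL k) (pR k) σ.1 (pL k) = true; rw [spinFlip_apply_left (pL_ne_pR k)]; exact h2
  have hf2 : (flipV (pL_ne_pR k) σ).1 (pR k) = false := by
    show spinFlip (pL k) (pR k) σ.1 (pR k) = false; rw [spinFlip_apply_right]; exact h1
  have hff : flipV (pL_ne_pR k) (flipV (pL_ne_pR k) σ) = σ := Subtype.ext (spinFlip_spinFlip (pL_ne_pR k) σ.1)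
  rw [vecMul_secU q (pL_ne_pR k) y (flipV (pL_ne_pR k) σ), vecMul_secU q (pL_ne_pR k) y σ, hf1, hf2, h1, h2, hff,
    if_neg (by decide), if_neg (by decide)]
  simp only [tlDiag, if_true, Bool.false_eq_true, if_false]
  field_simp
  ring

omit hq in
/-- Multiplying by `U` at another pair preserves properties A and B. [folklore] -/
theorem propAB_vecMul_of_ne {y : VSec (2 * m + 1) m → ℂ} {j k : Fin m} (hjk : j ≠ k) (hA : PropA y j) (hB : PropB q y j) :
    PropA (y ᵥ* secU q (pL k) (pR k)) j ∧ PropB q (y ᵥ* secU q (pL k) (pR k)) j := by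
  have h1 : pL j ≠ pL k := fun h => hjk (Fin.ext (by have := congrArg Fin.val h; simp [pL] at this; omega))
  have h2 : pL j ≠ pR k := fun h => by have := congrArg Fin.val h; simp [pL, pR] at this; omega
  have h3 : pR j ≠ pL k := fun h => by have := congrArg Fin.val h; simp [pL, pR] at this; omega
  have h4 : pR j ≠ pR k := fun h => hjk (Fin.ext (by have := congrArg Fin.val h; simp [pR] at this; omega))
  -- the move at `k` does not touch the pair `j`
  have hkL : ∀ σ : VSec (2 * m + 1) m, (flipV (pL_ne_pR k) σ).1 (pL j) = σ.1 (pL j) := fun σ => spinFlip_apply_of_ne h1 h2 σ.1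
  have hkR : ∀ σ : VSec (2 * m + 1) m, (flipV (pL_ne_pR k) σ).1 (pR j) = σ.1 (pR j) := fun σ => spinFlip_apply_of_ne h3 h4 σ.1
  have hjL : ∀ σ : VSec (2 * m + 1) m, (flipV (pL_ne_pR j) σ).1 (pL k) = σ.1 (pL k) := fun σ =>
    spinFlip_apply_of_ne (Ne.symm h1) (Ne.symm h3) σ.1
  have hjR : ∀ σ : VSec (2 * m + 1) m, (flipV (pL_ne_pR j) σ).1 (pR k) = σ.1 (pR k) := fun σ =>
    spinFlip_apply_of_ne (Ne.symm h2) (Ne.symm h4) σ.1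
  have hcomm : ∀ σ : VSec (2 * m + 1) m, flipV (pL_ne_pR k) (flipV (pL_ne_pR j) σ) = flipV (pL_ne_pR j) (flipV (pL_ne_pR k) σ) :=
    fun σ => Subtype.ext (spinFlip_comm (Ne.symm h1) (Ne.symm h3) (Ne.symm h2) (Ne.symm h4) σ.1)
  refine ⟨fun σ h => ?_, fun σ hl hr => ?_⟩
  · rw [vecMul_secU q (pL_ne_pR k)]
    split_ifs
    · rfl
    · rw [hA σ h, hA _ (by rw [hkL, hkR]; exact h), mul_zero, add_zero]
  · rw [vecMul_secU q (pL_ne_pR k), vecMul_secU q (pL_ne_pR k), hjL, hjR]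
    split_ifs
    · ring
    · rw [hB σ hl hr, hcomm, hB _ (by rw [hkL]; exact hl) (by rw [hkR]; exact hr)]
      ring

/-- The partial products `U_1 U_3 ⋯ U_{2k-1}` (with identities interleaved). [folklore] -/
def oddPartial (m : ℕ) (q : ℂ) (k : ℕ) : Matrix (VSec (2 * m + 1) m) (VSec (2 * m + 1) m) ℂ :=
  ((List.range (2 * k)).map fun t => if t % 2 = 0 then vE (2 * m + 1) m q (t + 1) else 1).prod

omit hq in
/-- The recursion of the partial products. [folklore] -/
theorem oddPartial_succ {k : ℕ} (hk : k < m) :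
    oddPartial m q (k + 1) = oddPartial m q k * secU q (pL ⟨k, hk⟩) (pR ⟨k, hk⟩) := by
  rw [oddPartial, show 2 * (k + 1) = 2 * k + 1 + 1 by ring, List.range_succ, List.range_succ, List.map_append, List.map_append,
    List.prod_append, List.prod_append, List.map_singleton, List.map_singleton, List.prod_singleton, List.prod_singleton,
    if_pos (by omega), if_neg (by omega), Matrix.mul_one, ← oddPartial]
  congr 1
  rw [vE, dif_pos ⟨by omega, by omega⟩]
  rfl

omit hq in
/-- The full product is `oddProdE`. [folklore] -/
theorem oddPartial_eq_oddProdE : oddPartial m q m = oddProdE (vE (2 * m + 1) m q) m := rfl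

/-- **Properties A and B at every pair for `x ᵥ* U_1 U_3 ⋯ U_{2m-1}`.** [folklore] -/
theorem propAB_vecMul_oddPartial : ∀ {k : ℕ} (_ : k ≤ m) (x : VSec (2 * m + 1) m → ℂ) (j : Fin m), j.val < k →
    PropA (x ᵥ* oddPartial m q k) j ∧ PropB q (x ᵥ* oddPartial m q k) j
  | 0, _, x, j, hj => absurd hj (Nat.not_lt_zero _)
  | k + 1, hk, x, j, hj => by
    rw [oddPartial_succ (by omega : k < m), ← Matrix.vecMul_vecMul]
    by_cases hjk : j.val = k
    · have : j = ⟨k, by omega⟩ := Fin.ext hjk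
      rw [this]
      exact propAB_vecMul_self hq _ _
    · have ih := propAB_vecMul_oddPartial (k := k) (by omega) x j (by omega)
      exact propAB_vecMul_of_ne (fun h => hjk (congrArg Fin.val h)) ih.1 ih.2

/-- The number of pairs in the state `↓↑`. [folklore] -/
def downPairs (σ : VSec (2 * m + 1) m) : ℕ := (univ.filter fun j : Fin m => σ.1 (pL j) = true).card

/-- The fixed row: alternating pairs weighted by `(-q)^{#↓↑}`. [folklore] -/
def wRow (q : ℂ) (σ : VSec (2 * m + 1) m) : ℂ := if ∀ j : Fin m, σ.1 (pL j) ≠ σ.1 (pR j) then (-q) ^ downPairs σ else 0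

/-- The alternating configuration `↑↓↑↓⋯↑`. [folklore] -/
def altConf (m : ℕ) : SpinConfig (2 * m + 1) := fun i => decide (i.val % 2 = 1)

omit hq in
/-- The alternating configuration has `m` down spins. [folklore] -/
theorem downCount_altConf (m : ℕ) : downCount (altConf m) = m := by
  unfold downCount altConf
  have : (univ.filter fun i : Fin (2 * m + 1) => decide (i.val % 2 = 1) = true) = univ.map ⟨pR, fun a b h => by
      have := congrArg Fin.val h; simp [pR] at this; exact Fin.ext (by omega)⟩ := by
    ext i
    simp only [mem_filter, mem_univ, true_and, decide_eq_true_eq, mem_map, Function.Embedding.coeFn_mk]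
    constructor
    · intro h; exact ⟨⟨i.val / 2, by omega⟩, Fin.ext (by simp [pR]; omega)⟩
    · rintro ⟨j, rfl⟩; simp [pR]
  rw [this, card_map, card_univ, Fintype.card_fin]

/-- The alternating state of the sector. [folklore] -/
def altV (m : ℕ) : VSec (2 * m + 1) m := ⟨altConf m, downCount_altConf m⟩

omit hq in
/-- **An alternating configuration of the sector has its last spin up and is determined by its down pairs**:
if no pair is `↓↑` it is the alternating configuration. [folklore] -/
theorem eq_altV_of_downPairs_eq_zero {σ : VSec (2 * m + 1) m} (halt : ∀ j : Fin m, σ.1 (pL j) ≠ σ.1 (pR j))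
    (h0 : downPairs σ = 0) : σ = altV m := by
  have hL : ∀ j : Fin m, σ.1 (pL j) = false := fun j => by
    by_contra h
    have : j ∈ univ.filter (fun j : Fin m => σ.1 (pL j) = true) := mem_filter.2 ⟨mem_univ _, by simpa using h⟩
    rw [downPairs, card_eq_zero] at h0
    rw [h0] at this; exact absurd this (notMem_empty _)
  have hR : ∀ j : Fin m, σ.1 (pR j) = true := fun j => by
    have := halt j; rw [hL j] at this
    cases h : σ.1 (pR j)
    · exact absurd h.symm this
    · rfl
  -- the last spin is up by counting
  have hlast : σ.1 ⟨2 * m, by omega⟩ = false := by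
    by_contra h
    have hsub : insert (⟨2 * m, by omega⟩ : Fin (2 * m + 1)) (univ.map ⟨pR, fun a b h => by
        have := congrArg Fin.val h; simp [pR] at this; exact Fin.ext (by omega)⟩) ⊆ univ.filter (fun i => σ.1 i = true) := by
      intro i hi
      rw [mem_insert, mem_map] at hi
      rw [mem_filter]
      rcases hi with rfl | ⟨j, _, rfl⟩
      · exact ⟨mem_univ _, by simpa using h⟩
      · exact ⟨mem_univ _, hR j⟩
    have := card_le_card hsub
    rw [card_insert_of_notMem (by simp [pR]; intro j h'; omega), card_map, card_univ, Fintype.card_fin] at this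
    have hc : (univ.filter (fun i => σ.1 i = true)).card = m := σ.2
    omega
  apply Subtype.ext
  funext i
  show σ.1 i = decide (i.val % 2 = 1)
  rcases Nat.lt_or_ge i.val (2 * m) with hi | hi
  · rcases Nat.mod_two_eq_zero_or_one i.val with h2 | h2
    · have : i = pL ⟨i.val / 2, by omega⟩ := Fin.ext (by simp [pL]; omega)
      rw [this, hL]; simp [pL]
    · have : i = pR ⟨i.val / 2, by omega⟩ := Fin.ext (by simp [pR]; omega)
      rw [this, hR]; simp [pR]
  · have : i = ⟨2 * m, by omega⟩ := Fin.ext (by have := i.isLt; simp; omega)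
    rw [this, hlast]; simp

omit hq in
/-- Flipping a `↓↑` pair to `↑↓` lowers the number of down pairs by one and keeps alternation. [folklore] -/
theorem downPairs_flipV {σ : VSec (2 * m + 1) m} {j : Fin m} (hl : σ.1 (pL j) = true) (hr : σ.1 (pR j) = false) :
    downPairs (flipV (pL_ne_pR j) σ) + 1 = downPairs σ := by
  unfold downPairs
  have hset : (univ.filter fun k : Fin m => (flipV (pL_ne_pR j) σ).1 (pL k) = true) =
      (univ.filter fun k : Fin m => σ.1 (pL k) = true).erase j := by
    ext k
    simp only [mem_filter, mem_univ, true_and, mem_erase]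
    by_cases hkj : k = j
    · subst hkj
      show spinFlip (pL k) (pR k) σ.1 (pL k) = true ↔ _
      rw [spinFlip_apply_left (pL_ne_pR k), hr]; simp
    · have h1 : pL k ≠ pL j := fun h => hkj (Fin.ext (by have := congrArg Fin.val h; simp [pL] at this; omega))
      have h2 : pL k ≠ pR j := fun h => by have := congrArg Fin.val h; simp [pL, pR] at this; omega
      show spinFlip (pL j) (pR j) σ.1 (pL k) = true ↔ _
      rw [spinFlip_apply_of_ne h1 h2]; simp [hkj]
  rw [hset, card_erase_of_mem (s := univ.filter fun k : Fin m => σ.1 (pL k) = true) (a := j) (mem_filter.2 ⟨mem_univ _, hl⟩)]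
  have : 0 < (univ.filter fun k : Fin m => σ.1 (pL k) = true).card := card_pos.2 ⟨j, mem_filter.2 ⟨mem_univ _, hl⟩⟩
  omega

omit hq in
/-- **A vector with properties A and B at every pair lies on the line of `wRow`.** [folklore] -/
theorem eq_smul_wRow {y : VSec (2 * m + 1) m → ℂ} (hA : ∀ j, PropA y j) (hB : ∀ j, PropB q y j) : y = y (altV m) • wRow q := by
  funext σ
  rw [Pi.smul_apply, smul_eq_mul, wRow]
  by_cases halt : ∀ j : Fin m, σ.1 (pL j) ≠ σ.1 (pR j)
  · rw [if_pos halt]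
    -- induction on the number of down pairs
    suffices H : ∀ d (σ : VSec (2 * m + 1) m), (∀ j : Fin m, σ.1 (pL j) ≠ σ.1 (pR j)) → downPairs σ = d →
        y σ = y (altV m) * (-q) ^ d from H _ σ halt rfl
    intro d
    induction d with
    | zero => intro σ hσ h0; rw [eq_altV_of_downPairs_eq_zero hσ h0, pow_zero, mul_one]
    | succ d ih =>
      intro σ hσ hd
      obtain ⟨j, hj⟩ : ∃ j : Fin m, σ.1 (pL j) = true := by
        by_contra h
        push Not at h
        have : downPairs σ = 0 := by
          rw [downPairs, card_eq_zero, filter_eq_empty_iff]; intro k _; simpa using h k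
        omega
      have hr : σ.1 (pR j) = false := by
        have := hσ j; rw [hj] at this
        cases h : σ.1 (pR j)
        · rfl
        · exact absurd h.symm this
      have hσ'l : (flipV (pL_ne_pR j) σ).1 (pL j) = false := by show spinFlip _ _ σ.1 _ = false; rw [spinFlip_apply_left (pL_ne_pR j)]; exact hr
      have hσ'r : (flipV (pL_ne_pR j) σ).1 (pR j) = true := by show spinFlip _ _ σ.1 _ = true; rw [spinFlip_apply_right]; exact hj
      have hσ'alt : ∀ k : Fin m, (flipV (pL_ne_pR j) σ).1 (pL k) ≠ (flipV (pL_ne_pR j) σ).1 (pR k) := by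
        intro k
        by_cases hkj : k = j
        · subst hkj; rw [hσ'l, hσ'r]; decide
        · have h1 : pL k ≠ pL j := fun h => hkj (Fin.ext (by have := congrArg Fin.val h; simp [pL] at this; omega))
          have h2 : pL k ≠ pR j := fun h => by have := congrArg Fin.val h; simp [pL, pR] at this; omega
          have h3 : pR k ≠ pL j := fun h => by have := congrArg Fin.val h; simp [pL, pR] at this; omega
          have h4 : pR k ≠ pR j := fun h => hkj (Fin.ext (by have := congrArg Fin.val h; simp [pR] at this; omega))
          show spinFlip _ _ σ.1 _ ≠ spinFlip _ _ σ.1 _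
          rw [spinFlip_apply_of_ne h1 h2, spinFlip_apply_of_ne h3 h4]; exact hσ k
      have hd' : downPairs (flipV (pL_ne_pR j) σ) = d := by have := downPairs_flipV hj hr; omega
      have hback : flipV (pL_ne_pR j) (flipV (pL_ne_pR j) σ) = σ := Subtype.ext (spinFlip_spinFlip (pL_ne_pR j) σ.1)
      rw [← hback, hB j _ hσ'l hσ'r, ih _ hσ'alt hd', pow_succ]
      ring
  · rw [if_neg halt, mul_zero]
    push Not at halt
    obtain ⟨j, hj⟩ := halt
    exact hA j σ hj

/-- **`U_1 U_3 ⋯ U_{2m-1}` has rank one on the sector.** [folklore] -/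
theorem vecMul_oddProd_line (x : VSec (2 * m + 1) m → ℂ) : ∃ a : ℂ, x ᵥ* oddProdE (vE (2 * m + 1) m q) m = a • wRow q := by
  have h := fun j : Fin m => propAB_vecMul_oddPartial hq le_rfl x j j.isLt
  rw [oddPartial_eq_oddProdE] at h
  exact ⟨_, eq_smul_wRow (fun j => (h j).1) (fun j => (h j).2)⟩

end RankOne

/-! ### Conclusion -/

section Conclusion

variable {m : ℕ} {q : ℂ} (hq : q ^ 2 + q + 1 = 0)
include hq

/-- **Uniqueness of the exact boundary qKZ solution on the vertex representation**: two vectors on the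
spin chain of `2m+1` sites, vanishing off the sector with `m` down spins, satisfying the exchange
relations `[q z_t/z_s] Φ_σ - [z_s/z_t] (U_{s,t} Φ)_σ = [q z_s/z_t] σ_s Φ_σ` at every adjacent pair and
the two reflections with the same monomial twist, are proportional over the rapidity field.
[cite: IkhlefPonsaing2012, §3.4 (20)–(22)] -/
theorem vertex_solutions_proportional {Φ Φ' : SpinConfig (2 * m + 1) → RapidityField ℂ} {a : ℤ}
    (hz : ∀ σ, downCount σ ≠ m → Φ σ = 0)
    (hex : ∀ s t : Fin (2 * m + 1), t.val = s.val + 1 → ∀ σ,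
      qbr (genC ℂ q * zv t / zv s) * Φ σ - qbr (zv s / zv t) * spinTL (genC ℂ q) s t Φ σ =
        qbr (genC ℂ q * zv s / zv t) * genSwap ℂ (s.val + 1) (Φ σ))
    (hbot : ∀ σ, genInv ℂ 1 (Φ σ) = genZ ℂ 1 ^ (2 * a) * Φ σ)
    (htop : ∀ σ, genInv ℂ (2 * m + 1) (Φ σ) = genZ ℂ (2 * m + 1) ^ (2 * a) * Φ σ)
    (hz' : ∀ σ, downCount σ ≠ m → Φ' σ = 0)
    (hex' : ∀ s t : Fin (2 * m + 1), t.val = s.val + 1 → ∀ σ,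
      qbr (genC ℂ q * zv t / zv s) * Φ' σ - qbr (zv s / zv t) * spinTL (genC ℂ q) s t Φ' σ =
        qbr (genC ℂ q * zv s / zv t) * genSwap ℂ (s.val + 1) (Φ' σ))
    (hbot' : ∀ σ, genInv ℂ 1 (Φ' σ) = genZ ℂ 1 ^ (2 * a) * Φ' σ)
    (htop' : ∀ σ, genInv ℂ (2 * m + 1) (Φ' σ) = genZ ℂ (2 * m + 1) ^ (2 * a) * Φ' σ) (σ₀ σ : SpinConfig (2 * m + 1)) :
    Φ' σ₀ * Φ σ = Φ σ₀ * Φ' σ := by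
  have hexV : ∀ (Ψ : SpinConfig (2 * m + 1) → RapidityField ℂ), (∀ σ, downCount σ ≠ m → Ψ σ = 0) →
      (∀ s t : Fin (2 * m + 1), t.val = s.val + 1 → ∀ σ,
        qbr (genC ℂ q * zv t / zv s) * Ψ σ - qbr (zv s / zv t) * spinTL (genC ℂ q) s t Ψ σ =
          qbr (genC ℂ q * zv s / zv t) * genSwap ℂ (s.val + 1) (Ψ σ)) →
      ∀ i, 1 ≤ i → i ≤ 2 * m → ∀ τ : VSec (2 * m + 1) m,
        genSwap ℂ i (Ψ τ.1) = ((fun τ' : VSec (2 * m + 1) m => Ψ τ'.1) ᵥ* eR (vE (2 * m + 1) m q) q i (genZ ℂ i) (genZ ℂ (i + 1))) τ := by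
    intro Ψ hΨz hΨ i hi1 hi2 τ
    have h := hΨ ⟨i - 1, by omega⟩ ⟨i, by omega⟩ (by simp only; omega)
    simp only [show i - 1 + 1 = i by omega] at h
    exact hexV_of_exchange (n := m) hq hi1 (by omega) hΨz h τ
  by_cases h0 : downCount σ₀ = m
  · by_cases h1 : downCount σ = m
    · have := solutionsE_proportional hq (vecMul_oddProd_line hq) (v := fun τ : VSec (2 * m + 1) m => Φ τ.1)
        (v' := fun τ : VSec (2 * m + 1) m => Φ' τ.1) (a := a) (hexV Φ hz hex) (fun τ => hbot τ.1) (fun τ => htop τ.1)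
        (hexV Φ' hz' hex') (fun τ => hbot' τ.1) (fun τ => htop' τ.1) ⟨σ₀, h0⟩
      have := congrFun this ⟨σ, h1⟩
      simpa using this
    · rw [hz σ h1, hz' σ h1, mul_zero, mul_zero]
  · rw [hz σ₀ h0, hz' σ₀ h0, zero_mul, zero_mul]

end Conclusion

end Literature.Probability.Percolation
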